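import Literature.NumberTheory.GaloisCohomology.Howard2004.TransportUnramified
import Literature.NumberTheory.GaloisRepresentations.UnramifiedSubgroupMapSurjective
import HarnessLib

/-!
# H.5(b) at the UNRAMIFIED places: the propagated unramified condition is unramified, and `τ` carries it to
# itself (theorems only; no definition, no named fact, no instance)

Topic `NumberTheory/GaloisCohomology` (typed Howard 2004, companion of `SelmerTriples` (§F: `IsQuotientBy.propagate`,
`ConjugationDatum.transportH1`, `ResidualTau.thetaH1`, `H5b`), `TransportUnramified` (conjugation by `τ` carries
`H¹_ur(K_{σv}, T)` onto `H¹_ur(K_v, Tw T)`) and `GaloisRepresentations/UnramifiedSubgroupMapSurjective` (`H¹(f)` maps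
`H¹_ur` ONTO `H¹_ur` for an equivariant surjection out of an unramified finite module)).

Howard's hypothesis H.5(b) [arXiv 1202.6340 p. 7, L96–97]: «the condition `F` propagated to `T̄` is stable under the
action of `G_ℚ`» — typed as `Howard2004.H5b`: at every finite place `v`,
`(F̄_{σv}).map (θ_* ∘ transport_v) = F̄_v`, `F̄ = F` propagated to the residual presentation `π̄ : T ↠ T̄ = T/𝔪T`
(`IsQuotientBy.propagateStructure`), `transport_v : H¹(K_{σv}, T̄) → H¹(K_v, Tw T̄)` the conjugation-by-`τ` isomorphism of
the conjugation datum and `θ_* = H¹(θ)`, `θ : Tw T̄ ⥲ T̄` the action of `τ` (`ResidualTau`).  This file settles the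
clause at the places where `F` is the UNRAMIFIED condition on both sides (`v` and `σv` outside `Σ(F)`), for `T` finite
and unramified there:

* §1 `cohomologyMap_one_eq_map` — lit's `ContinuousRep.cohomologyMap` (of an additive equivariant map) IS
  `galoisCohomology.map` of the corresponding continuous intertwining map, in degree `1` (same function on cocycles).
* §2 **`IsQuotientBy.propagate_inr_unramifiedSubgroup_eq`** — `F` propagated from `T` to `T/IT` at `v` sends
  `H¹_ur(K_v, T)` ONTO `H¹_ur(K_v, T/IT)` (`T` finite, unramified at `v`; Mazur–Rubin Lemma 1.1.5 / Ex. 1.1.6: the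
  unramified condition is cartesian on quotients).
* §3 **`ResidualTau.map_thetaH1_inr_unramifiedSubgroup_eq`** — `θ_*` carries `H¹_ur(K_v, Tw T̄)` onto `H¹_ur(K_v, T̄)`
  (`θ` is an equivariant bijection `Tw T̄ → T̄`).
* §4 **`IsQuotientBy.map_thetaH1_comp_transportH1_propagateStructure_eq_of_unramified`** — the `v`-clause of `H5b`
  VERBATIM when `𝓕 v = H¹_ur(K_v, T)`, `𝓕 (σv) = H¹_ur(K_{σv}, T)`, `T` finite and unramified at `v` and `σ v`, and the
  transport `φ_v` of the conjugation datum respects inertia (automatic for `ConjugationDatum.ofLifts`,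
  `phi_mem_absInertia_iff`): `_ofLifts` form.

References: [Howard2004HeegnerKolyvagin] §1.1 Def. 1.1.3 (propagation), §1.3 H.5(b) (arXiv p. 7, L96–97), Def. 2.1.10
(`H¹_F = H¹_unr` outside `Σ(F)`); [MazurRubin2004] Lemma 1.1.5, Example 1.1.6; [SerreLocalFields1979] XIII §1 Prop. 1;
[MilneADT2006] I §2. BSD is not proved by any of this.
-/

noncomputable section

open Function Field IsDedekindDomain
open scoped NumberField ContRepresentation

namespace Literature.NumberTheory.GaloisCohomology.Howard2004

open Literature.NumberTheory.GaloisRepresentations Literature.NumberTheory.EllipticCurves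
open Literature.NumberTheory.GaloisRepresentations.DiscreteGaloisModule (SelmerStructure)

/-! ## §1 `ContinuousRep.cohomologyMap` is `galoisCohomology.map` in degree one -/

section Bridge

variable {F : Type} [Field F] {V V' : Type} [AddCommGroup V] [TopologicalSpace V] [DiscreteTopology V]
  [AddCommGroup V'] [TopologicalSpace V'] [DiscreteTopology V']
  (τ : DiscreteGaloisModule F V) (τ' : DiscreteGaloisModule F V')

/-- **lit's `ContinuousRep.cohomologyMap` of an additive equivariant map `π` equals `galoisCohomology.map f` for any
continuous intertwining map `f` with the same underlying function** (degree `1`: both send `[φ]` to `[π ∘ φ]`).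
[cite: SerreGaloisCohomology1997, I §2.2 (functoriality in the module)] -/
theorem cohomologyMap_one_eq_map (π : V →+ V') (hπ : Continuous π)
    (h : ∀ (g : absoluteGaloisGroup F) (x : V), π (τ g x) = τ' g (π x))
    (f : τ.toContRepresentation →ⁱL τ'.toContRepresentation) (hf : ∀ x, f x = π x) :
    ContinuousRep.cohomologyMap τ τ' π hπ h 1 = galoisCohomology.map f 1 := by
  refine AddMonoidHom.ext fun x ↦ ?_
  obtain ⟨φ, rfl⟩ := oneCocycleClass_surjective τ.toTopRep x
  have h1 : ContinuousRep.cohomologyMap τ τ' π hπ h 1 (oneCocycleClass τ.toTopRep φ) =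
      oneCocycleClass τ'.toTopRep
        (contOneCocycles.pullback (ContinuousMonoidHom.id (absoluteGaloisGroup F))
          (X := τ.toTopRep) (Y := τ'.toTopRep)
          (TopRep.ofHom ⟨⟨π.toIntLinearMap, hπ⟩, fun g ↦ ContinuousLinearMap.ext fun x ↦ h g x⟩) φ) :=
    map_oneCocycleClass _ _ _ φ
  have h2 : galoisCohomology.map f 1 (oneCocycleClass τ.toTopRep φ) =
      oneCocycleClass τ'.toTopRep
        (contOneCocycles.pullback (ContinuousMonoidHom.id (absoluteGaloisGroup F))
          (X := τ.toTopRep) (Y := τ'.toTopRep)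
          (TopRep.ofHom ⟨f.toContinuousLinearMap, f.isIntertwining'⟩) φ) :=
    map_oneCocycleClass _ _ _ φ
  rw [h1]
  refine Eq.trans ?_ h2.symm
  congr 1
  exact Subtype.ext (ContinuousMap.ext fun σ ↦ (hf (φ.1 σ)).symm)

end Bridge

/-! ## §2 Propagating the unramified condition along `T ↠ T/IT` -/

section Propagate

variable {K : Type} [Field K] [NumberField K] {M : Type} [AddCommGroup M] [TopologicalSpace M]
  [DiscreteTopology M] {R : Type} [CommRing R] [Module R M]
  {N : Type} [AddCommGroup N] [TopologicalSpace N] [DiscreteTopology N] [Module R N]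
  {ρ : DiscreteGaloisModule K M} {I : Ideal R} {ρI : DiscreteGaloisModule K N} {π : M →ₗ[R] N}

/-- **`F` propagated from `T` to `T/IT` sends `H¹_ur(K_v, T)` ONTO `H¹_ur(K_v, T/IT)`** for `T` finite and unramified at
the finite place `v` (the presentation `π : T ↠ T/IT` is an equivariant surjection; `UnramifiedSubgroupMapSurjective`).
[cite: Howard2004HeegnerKolyvagin, Def. 1.1.3 and Def. 2.1.10] [cite: MazurRubin2004, Lemma 1.1.5 and Example 1.1.6] -/
theorem IsQuotientBy.propagate_inr_unramifiedSubgroup_eq [Finite M] (h : IsQuotientBy ρ I ρI π)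
    {v : HeightOneSpectrum (𝓞 K)} (hur : GaloisRep.IsUnramifiedAt v ρ) :
    h.propagate (Sum.inr v) (DiscreteGaloisModule.unramifiedSubgroup (GaloisRep.toLocal v ρ) 1) =
      (DiscreteGaloisModule.unramifiedSubgroup (GaloisRep.toLocal v ρI) 1 :) := by
  let f : (GaloisRep.toLocal v ρ).toContRepresentation →ⁱL (GaloisRep.toLocal v ρI).toContRepresentation :=
    { toContinuousLinearMap := ⟨π.toAddMonoidHom.toIntLinearMap, continuous_of_discreteTopology⟩
      isIntertwining' := fun g ↦ ContinuousLinearMap.ext fun m ↦ h.equivariant _ m }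
  have hb : h.localCohomologyMap (Sum.inr v) 1 = galoisCohomology.map f 1 :=
    cohomologyMap_one_eq_map (GaloisRep.toLocal v ρ) (GaloisRep.toLocal v ρI) π.toAddMonoidHom
      continuous_of_discreteTopology (fun _ m ↦ h.equivariant _ m) f fun _ ↦ rfl
  change (DiscreteGaloisModule.unramifiedSubgroup (GaloisRep.toLocal v ρ) 1).map (h.localCohomologyMap (Sum.inr v) 1) = _
  rw [hb]
  exact galoisCohomology.map_unramifiedSubgroup_eq_of_surjective (F := v.adicCompletion K)
    (GaloisRep.toLocal v ρ) (GaloisRep.toLocal v ρI) f h.surjective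
    fun _ hσ x ↦ GaloisRep.toLocal_apply_eq_self_of_isUnramifiedAt ρ hur hσ x

/-- The same for a Selmer structure whose condition at `v` IS the unramified one: the propagated structure is
unramified at `v`. [cite: Howard2004HeegnerKolyvagin, Def. 1.1.3 and Def. 2.1.10] [cite: MazurRubin2004, Lemma 1.1.5 and Example 1.1.6] -/
theorem IsQuotientBy.propagateStructure_inr_eq_unramifiedSubgroup [Finite M] (h : IsQuotientBy ρ I ρI π)
    (𝓕 : SelmerStructure ρ) {v : HeightOneSpectrum (𝓞 K)}
    (hv : 𝓕 (Sum.inr v) = DiscreteGaloisModule.unramifiedSubgroup (GaloisRep.toLocal v ρ) 1)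
    (hur : GaloisRep.IsUnramifiedAt v ρ) :
    h.propagateStructure 𝓕 (Sum.inr v) =
      (DiscreteGaloisModule.unramifiedSubgroup (GaloisRep.toLocal v ρI) 1 :) := by
  change h.propagate (Sum.inr v) (𝓕 (Sum.inr v)) = _
  rw [hv]
  exact h.propagate_inr_unramifiedSubgroup_eq hur

end Propagate

/-! ## §3 `θ_*` carries `H¹_ur(K_v, Tw T̄)` onto `H¹_ur(K_v, T̄)` -/

section Theta

variable {K : Type} [Field K] [NumberField K] {R : Type} [CommRing R]
  {cd : ConjugationDatum K} {Nbar : Type} [AddCommGroup Nbar] [TopologicalSpace Nbar]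
  [DiscreteTopology Nbar] [Module R Nbar] {ρbar : DiscreteGaloisModule K Nbar}

/-- **`H¹(θ)` maps `H¹_ur(K_v, Tw T̄)` ONTO `H¹_ur(K_v, T̄)`**: `θ : Tw T̄ → T̄` is an equivariant bijection (an
involution intertwining the `τ`-conjugate action with the action), and `H¹` of an equivariant bijection identifies
the unramified subgroups (`map_unramifiedSubgroup_eq_of_bijective`).
[cite: Howard2004HeegnerKolyvagin, H.5 (arXiv p. 7, L93–97)] [cite: MilneADT2006, Ch. I §2 (unramified cohomology)] -/
theorem ResidualTau.map_thetaH1_inr_unramifiedSubgroup_eq (A : ResidualTau (R := R) cd ρbar)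
    (v : HeightOneSpectrum (𝓞 K)) :
    (DiscreteGaloisModule.unramifiedSubgroup (GaloisRep.toLocal v (cd.twist ρbar)) 1 :).map (A.thetaH1 (Sum.inr v)) =
      (DiscreteGaloisModule.unramifiedSubgroup (GaloisRep.toLocal v ρbar) 1 :) := by
  let f : (GaloisRep.toLocal v (cd.twist ρbar)).toContRepresentation →ⁱL
      (GaloisRep.toLocal v ρbar).toContRepresentation :=
    { toContinuousLinearMap := ⟨A.θ.toAddMonoidHom.toIntLinearMap, continuous_of_discreteTopology⟩
      isIntertwining' := fun g ↦ ContinuousLinearMap.ext fun x ↦ A.compat _ x }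
  have hb : A.thetaH1 (Sum.inr v) = galoisCohomology.map f 1 :=
    cohomologyMap_one_eq_map (GaloisRep.toLocal v (cd.twist ρbar)) (GaloisRep.toLocal v ρbar) A.θ.toAddMonoidHom
      continuous_of_discreteTopology (fun _ x ↦ A.compat _ x) f fun _ ↦ rfl
  rw [hb]
  exact galoisCohomology.map_unramifiedSubgroup_eq_of_bijective f (Function.Involutive.bijective A.involutive)

end Theta

/-! ## §4 The `v`-clause of H.5(b) at an unramified place -/

section H5bClause

variable {K : Type} [Field K] [NumberField K] {M : Type} [AddCommGroup M] [TopologicalSpace M]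
  [DiscreteTopology M] {R : Type} [CommRing R] [Module R M]
  {cd : ConjugationDatum K} {Nbar : Type} [AddCommGroup Nbar] [TopologicalSpace Nbar]
  [DiscreteTopology Nbar] [Module R Nbar]
  {ρ : DiscreteGaloisModule K M} {I : Ideal R} {ρbar : DiscreteGaloisModule K Nbar} {πbar : M →ₗ[R] Nbar}

/-- **H.5(b) at a place where `F` is unramified on both sides.** For a presentation `π̄ : T ↠ T̄ = T/IT`, a datum `θ`
of the action of `τ` on `T̄`, and a Selmer structure `𝓕` with `𝓕_v = H¹_ur(K_v, T)` and `𝓕_{σv} = H¹_ur(K_{σv}, T)`,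
`T` finite and unramified at `v` and `σ v`, and a conjugation datum whose local transport `φ_v` respects the inertia
groups: `θ_* (transport_v (F̄_{σv})) = F̄_v` — all four groups being the unramified ones (§2, `TransportUnramified`,
§3). [cite: Howard2004HeegnerKolyvagin, H.5(b) (arXiv p. 7, L96–97) and Def. 2.1.10] [cite: MazurRubin2004, Lemma 1.1.5 and Example 1.1.6] -/
theorem IsQuotientBy.map_thetaH1_comp_transportH1_propagateStructure_eq_of_unramified [Finite M]
    (h : IsQuotientBy ρ I ρbar πbar) (A : ResidualTau (R := R) cd ρbar) (𝓕 : SelmerStructure ρ)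
    {v : HeightOneSpectrum (𝓞 K)}
    (hv : 𝓕 (Sum.inr v) = DiscreteGaloisModule.unramifiedSubgroup (GaloisRep.toLocal v ρ) 1)
    (hσv : 𝓕 (Sum.inr (cd.σ • v)) = DiscreteGaloisModule.unramifiedSubgroup (GaloisRep.toLocal (cd.σ • v) ρ) 1)
    (hur : GaloisRep.IsUnramifiedAt v ρ) (hurσ : GaloisRep.IsUnramifiedAt (cd.σ • v) ρ)
    (hI : ∀ g, g ∈ absInertia (v.adicCompletion K) ↔ cd.φ v g ∈ absInertia ((cd.σ • v).adicCompletion K)) :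
    ((h.propagateStructure 𝓕) (Sum.inr (cd.σ • v))).map ((A.thetaH1 (Sum.inr v)).comp (cd.transportH1 ρbar v)) =
      (h.propagateStructure 𝓕) (Sum.inr v) := by
  rw [h.propagateStructure_inr_eq_unramifiedSubgroup 𝓕 hσv hurσ, h.propagateStructure_inr_eq_unramifiedSubgroup 𝓕 hv hur,
    ← AddSubgroup.map_map, cd.map_transportH1_unramifiedSubgroup_eq ρbar v hI]
  exact A.map_thetaH1_inr_unramifiedSubgroup_eq v

/-- **H.5(b) at an unramified place for the CANONICAL conjugation datum `ConjugationDatum.ofLifts`** (its local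
transports respect inertia, `phi_mem_absInertia_iff`). [cite: Howard2004HeegnerKolyvagin, H.5(b) (arXiv p. 7, L96–97) and Def. 2.1.10]
[cite: MazurRubin2004, Lemma 1.1.5 and Example 1.1.6] -/
theorem IsQuotientBy.map_thetaH1_comp_transportH1_propagateStructure_eq_of_unramified_ofLifts [Finite M]
    (σ : K ≃ₐ[ℚ] K) (hσ₁ : σ ≠ 1) (hσ : σ * σ = 1) (τ : AlgebraicClosure K ≃+* AlgebraicClosure K)
    (hτ : IsLiftOfAut σ τ) (hτ₂ : Function.Involutive τ)
    {ρbar' : DiscreteGaloisModule K Nbar} {πbar' : M →ₗ[R] Nbar} (h : IsQuotientBy ρ I ρbar' πbar')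
    (A : ResidualTau (R := R) (ConjugationDatum.ofLifts σ hσ₁ hσ τ hτ hτ₂) ρbar') (𝓕 : SelmerStructure ρ)
    {v : HeightOneSpectrum (𝓞 K)}
    (hv : 𝓕 (Sum.inr v) = DiscreteGaloisModule.unramifiedSubgroup (GaloisRep.toLocal v ρ) 1)
    (hσv : 𝓕 (Sum.inr (σ • v)) = DiscreteGaloisModule.unramifiedSubgroup (GaloisRep.toLocal (σ • v) ρ) 1)
    (hur : GaloisRep.IsUnramifiedAt v ρ) (hurσ : GaloisRep.IsUnramifiedAt (σ • v) ρ) :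
    ((h.propagateStructure 𝓕) (Sum.inr (σ • v))).map
        ((A.thetaH1 (Sum.inr v)).comp ((ConjugationDatum.ofLifts σ hσ₁ hσ τ hτ hτ₂).transportH1 ρbar' v)) =
      (h.propagateStructure 𝓕) (Sum.inr v) :=
  h.map_thetaH1_comp_transportH1_propagateStructure_eq_of_unramified A 𝓕 hv hσv hur hurσ
    (ConjugationDatum.phi_mem_absInertia_iff hσ v)

end H5bClause

end Literature.NumberTheory.GaloisCohomology.Howard2004

end
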